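import Summits.Ventures.PercRepro.RLSStarStarCerts

/-!
# C-025 at q = 3: the ARITHMETIC CORE of the tail count (★★) as a kernel theorem (night-3 g2)

proofs/N3-TAIL-LOSSY.md §6: for a simple plane `G` on `g ≥ 10` points whose longest line `ℓ₁` has `k ≤ g − 2` points, the count
`w ≥ n₃/3 + 0.27·n₄ + 0.17·n₅ + 0.014·np` of the tail lemma follows from `Σ_ℓ cost_g(|ℓ|) ≤ A(g)`, and the line-profile reduction §6 (ii)
bounds the left side by `RHS(g, k) = cost_g(k) + (C(g−k,2)/3)·cost_g(min(k, g−k+1))`.  `rhs_le_A` proves `RHS(g, k) ≤ A(g)` for every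
`g ≥ 10` and every `3 ≤ k ≤ g − 2` — §6 (iii)–(iv) — in the kernel: the range `10 ≤ g ≤ 16` by exact evaluation, `g ≥ 17` by the case
split on `m = g − k` (`m = 2`, `m = 3`, `4 ≤ m ≤ 8`: one positivity certificate each (`RLSStarStarCerts`); `m ≥ 9`: the uniform bound
`cost_g(s) ≤ (1 + 1.014(g−s))·2^s` and three one-parameter inequalities in `m`); `profile_le_A` then gives the count for EVERY line
profile satisfying the two combinatorial constraints of §6 (ii) (every other line has `≤ min(k, g−k+1)` points; their pairs off the
longest line are disjoint, `Σ C(|ℓ|−1, 2) ≤ C(g−k, 2)`).  What stays on paper is §6 (i)–(ii)'s geometry: that a simple plane's line profile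
satisfies those two constraints, and the exact counts of `w`, `np`.  No `decide`, no `native_decide`.
-/

namespace PercRepro.NightThree.StarStar

open Finset
/-- Pascal for the partial sums: `S(s+1, j+1) = S(s, j+1) + S(s, j)`. -/
theorem S_succ (s j : ℕ) : S (s + 1) (j + 1) = S s (j + 1) + S s j := by
  induction j with
  | zero =>
    simp only [S, sum_range_succ, sum_range_zero, Nat.choose_zero_right, Nat.choose_one_right]
    push_cast
    ring
  | succ j ih =>
    have h1 : S (s + 1) (j + 1 + 1) = S (s + 1) (j + 1) + ((s + 1).choose (j + 2) : ℚ) := by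
      simp only [S, sum_range_succ]
    have h2 : S s (j + 1 + 1) = S s (j + 1) + (s.choose (j + 2) : ℚ) := by
      simp only [S, sum_range_succ]
    have h3 : S s (j + 1) = S s j + (s.choose (j + 1) : ℚ) := by
      simp only [S, sum_range_succ]
    rw [h1, h2, ih, h3, Nat.choose_succ_succ (s) (j + 1)]
    push_cast
    ring

/-- `S(s, j) ≤ S(s, j + 1)`. -/
theorem S_mono (s j : ℕ) : S s j ≤ S s (j + 1) := by
  simp only [S, sum_range_succ]
  have : (0 : ℚ) ≤ (s.choose (j + 1) : ℚ) := by positivity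
  linarith

/-- `cost_g` is increasing in `s` on `s + 2 ≤ g`. -/
theorem cost_mono (g s : ℕ) (hs : s + 2 ≤ g) : cost g s ≤ cost g (s + 1) := by
  unfold cost
  have e5 : S (s + 1) 5 = S s 5 + S s 4 := S_succ s 4
  have e4 : S (s + 1) 4 = S s 4 + S s 3 := S_succ s 3
  have e3 : S (s + 1) 3 = S s 3 + S s 2 := S_succ s 2
  rw [e5, e4, e3, pow_succ]
  have m5 : S s 4 ≤ S s 5 := S_mono s 4
  have m4 : S s 3 ≤ S s 4 := S_mono s 3
  have m3 : S s 2 ≤ S s 3 := S_mono s 2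
  have b5 := S_le_two_pow s 5
  have b4 := S_le_two_pow s 4
  have b3 := S_le_two_pow s 3
  have hg : (s : ℚ) + 2 ≤ g := by exact_mod_cast hs
  have hp : (0 : ℚ) ≤ 2 ^ s := by positivity
  push_cast
  nlinarith [mul_nonneg (show (0:ℚ) ≤ (g:ℚ) - s - 2 by linarith) (sub_nonneg.mpr b4),
    mul_nonneg (show (0:ℚ) ≤ (g:ℚ) - s - 2 by linarith) (sub_nonneg.mpr b3),
    mul_nonneg (show (0:ℚ) ≤ (g:ℚ) - s - 1 by linarith) (sub_nonneg.mpr m4),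
    mul_nonneg (show (0:ℚ) ≤ (g:ℚ) - s - 1 by linarith) (sub_nonneg.mpr m3)]

/-- `cost_g(a) ≤ cost_g(b)` for `a ≤ b`, `b + 2 ≤ g`. -/
theorem cost_le_of_le (g a b : ℕ) (hab : a ≤ b) (hb : b + 2 ≤ g) : cost g a ≤ cost g b := by
  induction b with
  | zero =>
    have : a = 0 := by omega
    subst this; exact le_rfl
  | succ b ih =>
    rcases Nat.lt_or_ge a (b + 1) with h | h
    · exact le_trans (ih (by omega) (by omega)) (cost_mono g b (by omega))
    · have : a = b + 1 := by omega
      subst this; exact le_rfl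

/-- Lines with at most 3 points cost nothing. -/
theorem cost_le_three (g s : ℕ) (hs : s ≤ 3) : cost g s = 0 := by
  interval_cases s <;> (simp only [cost, S, sum_range_succ, sum_range_zero]; norm_num [Nat.choose])

/-- `C(k−1, 2) ≥ 3` for `k ≥ 4`. -/
theorem three_le_choose (k : ℕ) (hk : 4 ≤ k) : 3 ≤ (k - 1).choose 2 := by
  have : (3 : ℕ) = (3).choose 2 := by norm_num [Nat.choose]
  rw [this]
  exact Nat.choose_le_choose 2 (by omega)

/-- One line of the profile: `cost_g(k) ≤ (C(k−1,2)/3)·cost_g(smax)` when `k ≤ smax`, `smax + 2 ≤ g`. -/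
theorem cost_le_pairs (g k smax : ℕ) (hk : k ≤ smax) (hs : smax + 2 ≤ g) :
    cost g k ≤ ((k - 1).choose 2 : ℚ) / 3 * cost g smax := by
  have hc := cost_nonneg g smax (by omega)
  rcases Nat.lt_or_ge k 4 with h | h
  · rw [cost_le_three g k (by omega)]; positivity
  · have h3 : (3 : ℚ) ≤ ((k - 1).choose 2 : ℚ) := by exact_mod_cast three_le_choose k h
    calc cost g k ≤ cost g smax := cost_le_of_le g k smax hk hs
      _ = 1 * cost g smax := by ring
      _ ≤ ((k - 1).choose 2 : ℚ) / 3 * cost g smax := mul_le_mul_of_nonneg_right (by linarith) hc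

/-- §6 (ii), arithmetic form: a list of line sizes, each `≤ smax`, with `Σ C(k−1,2) ≤ C(m,2)`, has total cost
`≤ (C(m,2)/3)·cost_g(smax)`. -/
theorem sum_cost_le (g smax m : ℕ) (ks : List ℕ) (hs : smax + 2 ≤ g) (hle : ∀ k ∈ ks, k ≤ smax)
    (hpairs : (ks.map (fun k => (k - 1).choose 2)).sum ≤ m.choose 2) :
    (ks.map (cost g)).sum ≤ (m.choose 2 : ℚ) / 3 * cost g smax := by
  have hc := cost_nonneg g smax (by omega)
  have key : ∀ l : List ℕ, (∀ k ∈ l, k ≤ smax) →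
      (l.map (cost g)).sum ≤ (((l.map (fun k => (k - 1).choose 2)).sum : ℕ) : ℚ) / 3 * cost g smax := by
    intro l
    induction l with
    | nil => intro _; simp
    | cons a t ih =>
      intro hl
      have ha := cost_le_pairs g a smax (hl a List.mem_cons_self) hs
      have ht := ih (fun k hk => hl k (List.mem_cons_of_mem a hk))
      simp only [List.map_cons, List.sum_cons]
      rw [Nat.cast_add]
      linarith [ha, ht]
  have hp : (((ks.map (fun k => (k - 1).choose 2)).sum : ℕ) : ℚ) ≤ (m.choose 2 : ℚ) := by exact_mod_cast hpairs
  calc (ks.map (cost g)).sum ≤ (((ks.map (fun k => (k - 1).choose 2)).sum : ℕ) : ℚ) / 3 * cost g smax := key ks hle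
    _ ≤ (m.choose 2 : ℚ) / 3 * cost g smax := by
      apply mul_le_mul_of_nonneg_right _ hc
      linarith

set_option maxHeartbeats 400000 in
/-- **The arithmetic core of the count (★★)**: `RHS(g, k) ≤ A(g)` for every `g ≥ 10` and every `3 ≤ k ≤ g − 2`. -/
theorem rhs_le_A (g k : ℕ) (hg : 10 ≤ g) (hk3 : 3 ≤ k) (hk : k + 2 ≤ g) : rhs g k ≤ A g := by
  rcases Nat.lt_or_ge g 17 with hlt | hge
  · -- the finite range `10 ≤ g ≤ 16`: exact evaluation
    have hk' : k ≤ 14 := by omega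
    interval_cases g <;> interval_cases k <;>
      first
      | omega
      | (simp only [rhs, cost, A, S, sum_range_succ, sum_range_zero]; norm_num [Nat.choose])
  · obtain ⟨m, rfl⟩ : ∃ m, g = k + m := ⟨g - k, by omega⟩
    have hm2 : 2 ≤ m := by omega
    have hmin : ∀ a b : ℕ, (k + m - k) = m := fun _ _ => by omega
    simp only [rhs, Nat.add_sub_cancel_left]
    have hA := C0_cert (k + m - 17)
    rw [show k + m - 17 + 17 = k + m by omega] at hA
    -- `m = 2`
    rcases Nat.lt_or_ge m 3 with h2 | h3
    · have hm : m = 2 := by omega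
      subst hm
      rw [show min k (2 + 1) = 3 from min_eq_right (by omega), cost_three]
      obtain ⟨j, rfl⟩ : ∃ j, k = j + 15 := ⟨k - 15, by omega⟩
      have := C1_cert j
      rw [show j + 15 + 2 = j + 17 by omega]
      norm_num [Nat.choose]
      linarith
    rcases Nat.lt_or_ge m 4 with h3' | h4
    · -- `m = 3`
      have hm : m = 3 := by omega
      subst hm
      rw [show min k (3 + 1) = 4 from min_eq_right (by omega)]
      obtain ⟨j, rfl⟩ : ∃ j, k = j + 14 := ⟨k - 14, by omega⟩
      have := C2_cert j
      rw [show j + 14 + 3 = j + 17 by omega]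
      norm_num [Nat.choose]
      linarith
    rcases Nat.lt_or_ge m 9 with h8 | h9
    · -- `4 ≤ m ≤ 8`: `k ≥ 9 ≥ m + 1`
      rw [show min k (m + 1) = m + 1 from min_eq_right (by omega)]
      obtain ⟨j, rfl⟩ : ∃ j, k = j + 17 - m := ⟨k + m - 17, by omega⟩
      interval_cases m
      · have := C3_4_cert j
        rw [show j + 17 - 4 + 4 = j + 17 by omega, show j + 17 - 4 = j + 13 by omega] at *
        norm_num [Nat.choose] at this ⊢; linarith
      · have := C3_5_cert j
        rw [show j + 17 - 5 + 5 = j + 17 by omega, show j + 17 - 5 = j + 12 by omega] at *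
        norm_num [Nat.choose] at this ⊢; linarith
      · have := C3_6_cert j
        rw [show j + 17 - 6 + 6 = j + 17 by omega, show j + 17 - 6 = j + 11 by omega] at *
        norm_num [Nat.choose] at this ⊢; linarith
      · have := C3_7_cert j
        rw [show j + 17 - 7 + 7 = j + 17 by omega, show j + 17 - 7 = j + 10 by omega] at *
        norm_num [Nat.choose] at this ⊢; linarith
      · have := C3_8_cert j
        rw [show j + 17 - 8 + 8 = j + 17 by omega, show j + 17 - 8 = j + 9 by omega] at *
        norm_num [Nat.choose] at this ⊢; linarith
    · -- `m ≥ 9`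
      have hA' : 9 / 10 * (2 : ℚ) ^ (k + m) ≤ A (k + m) := by linarith
      have hpow : (2 : ℚ) ^ (k + m) = 2 ^ k * 2 ^ m := pow_add 2 k m
      have hk0 : (0 : ℚ) ≤ 2 ^ k := by positivity
      have hm0 : (0 : ℚ) ≤ 2 ^ m := by positivity
      -- the uniform bound on the first term
      have hc1 : cost (k + m) k ≤ (1 + 1014 / 1000 * (m : ℚ)) * 2 ^ k := by
        have := cost_le (k + m) k (by omega)
        push_cast at this
        rwa [show ((k : ℚ) + m - k) = m by ring] at this
      -- L1: `1 + 1.014 m ≤ 0.316 · 2^m` (m ≥ 4)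
      have hL1 : 1 + 1014 / 1000 * (m : ℚ) ≤ 316 / 1000 * 2 ^ m := by
        obtain ⟨j, rfl⟩ : ∃ j, m = j + 4 := ⟨m - 4, by omega⟩
        have := L1_cert j
        push_cast
        linarith
      rcases Nat.lt_or_ge m k with hlt | hle
      · -- `k ≥ m + 1`: `min k (m+1) = m + 1`
        rw [show min k (m + 1) = m + 1 from min_eq_right (by omega)]
        have hc2 : cost (k + m) (m + 1) ≤ (1 + 1014 / 1000 * ((k : ℚ) - 1)) * 2 ^ (m + 1) := by
          have := cost_le (k + m) (m + 1) (by omega)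
          push_cast at this
          rwa [show ((k : ℚ) + m - (m + 1)) = k - 1 by ring] at this
        -- write `k = m + 1 + r`
        obtain ⟨r, rfl⟩ : ∃ r, k = m + 1 + r := ⟨k - (m + 1), by omega⟩
        have hr : (1 + 1014 / 1000 * (((m + 1 + r : ℕ) : ℚ) - 1)) ≤ (1 + 1014 / 1000 * (m : ℚ)) * 2 ^ r := by
          have h2r : (1 + (r : ℚ)) ≤ 2 ^ r := lin_le_two_pow r
          have hm1 : (0 : ℚ) ≤ 1 + 1014 / 1000 * (m : ℚ) := by positivity
          have hr0 : (0 : ℚ) ≤ r := by positivity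
          have hm9 : (9 : ℚ) ≤ m := by exact_mod_cast h9
          push_cast
          nlinarith [mul_le_mul_of_nonneg_left h2r hm1, mul_nonneg hr0 (show (0 : ℚ) ≤ 1014 / 1000 * (m : ℚ) - 14 / 1000 by linarith)]
        have hL2 : ((m).choose 2 : ℚ) / 3 * (1 + 1014 / 1000 * (m : ℚ)) ≤ 584 / 1000 * 2 ^ m := by
          obtain ⟨j, rfl⟩ : ∃ j, m = j + 9 := ⟨m - 9, by omega⟩
          have := L2_cert j
          push_cast at this ⊢
          linarith
        have hC : (0 : ℚ) ≤ ((m).choose 2 : ℚ) / 3 := by positivity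
        have hr0 : (0 : ℚ) ≤ 2 ^ r := by positivity
        have hm10 : (0 : ℚ) ≤ 2 ^ (m + 1) := by positivity
        have hpow2 : (2 : ℚ) ^ (m + 1 + r) = 2 ^ (m + 1) * 2 ^ r := pow_add 2 (m + 1) r
        have hpow3 : (2 : ℚ) ^ (m + 1) = 2 ^ m * 2 := pow_succ 2 m
        -- first term ≤ 0.316 · 2^(k+m), second ≤ 0.584 · 2^(k+m)
        have t1 : cost (m + 1 + r + m) (m + 1 + r) ≤ 316 / 1000 * 2 ^ (m + 1 + r + m) := by
          calc cost (m + 1 + r + m) (m + 1 + r) ≤ (1 + 1014 / 1000 * (m : ℚ)) * 2 ^ (m + 1 + r) := hc1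
            _ ≤ (316 / 1000 * 2 ^ m) * 2 ^ (m + 1 + r) := mul_le_mul_of_nonneg_right hL1 (by positivity)
            _ = 316 / 1000 * 2 ^ (m + 1 + r + m) := by rw [pow_add 2 (m + 1 + r) m]; ring
        have t2 : ((m).choose 2 : ℚ) / 3 * cost (m + 1 + r + m) (m + 1) ≤ 584 / 1000 * 2 ^ (m + 1 + r + m) := by
          calc ((m).choose 2 : ℚ) / 3 * cost (m + 1 + r + m) (m + 1)
              ≤ ((m).choose 2 : ℚ) / 3 * ((1 + 1014 / 1000 * (((m + 1 + r : ℕ) : ℚ) - 1)) * 2 ^ (m + 1)) :=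
                mul_le_mul_of_nonneg_left hc2 hC
            _ ≤ ((m).choose 2 : ℚ) / 3 * (((1 + 1014 / 1000 * (m : ℚ)) * 2 ^ r) * 2 ^ (m + 1)) :=
                mul_le_mul_of_nonneg_left (mul_le_mul_of_nonneg_right hr hm10) hC
            _ = (((m).choose 2 : ℚ) / 3 * (1 + 1014 / 1000 * (m : ℚ))) * (2 ^ r * 2 ^ (m + 1)) := by ring
            _ ≤ (584 / 1000 * 2 ^ m) * (2 ^ r * 2 ^ (m + 1)) := mul_le_mul_of_nonneg_right hL2 (by positivity)
            _ = 584 / 1000 * 2 ^ (m + 1 + r + m) := by rw [pow_add 2 (m + 1 + r) m, pow_add 2 (m + 1) r, pow_succ 2 m]; ring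
        linarith
      · -- `k ≤ m`: `min k (m+1) = k`
        rw [show min k (m + 1) = k from min_eq_left (by omega)]
        have hL3 : (1 + 1014 / 1000 * (m : ℚ)) * (1 + ((m).choose 2 : ℚ) / 3) ≤ 9 / 10 * 2 ^ m := by
          obtain ⟨j, rfl⟩ : ∃ j, m = j + 9 := ⟨m - 9, by omega⟩
          have := L3_cert j
          push_cast at this ⊢
          linarith
        have hC : (0 : ℚ) ≤ 1 + ((m).choose 2 : ℚ) / 3 := by positivity
        have hcn : 0 ≤ cost (k + m) k := cost_nonneg (k + m) k (by omega)
        calc cost (k + m) k + ((m).choose 2 : ℚ) / 3 * cost (k + m) k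
            = cost (k + m) k * (1 + ((m).choose 2 : ℚ) / 3) := by ring
          _ ≤ ((1 + 1014 / 1000 * (m : ℚ)) * 2 ^ k) * (1 + ((m).choose 2 : ℚ) / 3) := mul_le_mul_of_nonneg_right hc1 hC
          _ = ((1 + 1014 / 1000 * (m : ℚ)) * (1 + ((m).choose 2 : ℚ) / 3)) * 2 ^ k := by ring
          _ ≤ (9 / 10 * 2 ^ m) * 2 ^ k := mul_le_mul_of_nonneg_right hL3 hk0
          _ = 9 / 10 * 2 ^ (k + m) := by rw [hpow]; ring
          _ ≤ A (k + m) := hA'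

/-- `A(g) ≥ 0` for `g ≥ 10`. -/
theorem A_nonneg (g : ℕ) (hg : 10 ≤ g) : 0 ≤ A g := by
  rcases Nat.lt_or_ge g 17 with hlt | hge
  · interval_cases g <;> (simp only [A, S, sum_range_succ, sum_range_zero]; norm_num [Nat.choose])
  · have h := C0_cert (g - 17)
    rw [show g - 17 + 17 = g by omega] at h
    have : (0 : ℚ) ≤ 2 ^ g := by positivity
    linarith

/-- **The count (★★) for every admissible line profile** (N3-TAIL-LOSSY.md §6 (ii)–(iv)): `g ≥ 10` points, a longest line of
`k ≤ g − 2` points, and the other lines `ks` each with `≤ min(k, g − k + 1)` points and `Σ C(|ℓ| − 1, 2) ≤ C(g − k, 2)` (their pairs off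
the longest line are disjoint): the total cost is at most `A(g)`, i.e. `w ≥ n₃/3 + 0.27·n₄ + 0.17·n₅ + 0.014·np`. -/
theorem profile_le_A (g k : ℕ) (ks : List ℕ) (hg : 10 ≤ g) (hk : k + 2 ≤ g)
    (hle : ∀ k' ∈ ks, k' ≤ min k (g - k + 1))
    (hpairs : (ks.map (fun k' => (k' - 1).choose 2)).sum ≤ (g - k).choose 2) :
    cost g k + (ks.map (cost g)).sum ≤ A g := by
  rcases Nat.lt_or_ge k 3 with hk3 | hk3
  · have h0 : cost g k = 0 := cost_le_three g k (by omega)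
    have hs : (ks.map (cost g)).sum = 0 := by
      apply List.sum_eq_zero
      intro x hx
      rw [List.mem_map] at hx
      obtain ⟨k', hk', rfl⟩ := hx
      exact cost_le_three g k' (by have := hle k' hk'; omega)
    rw [h0, hs]
    simpa using A_nonneg g hg
  · have hmin : min k (g - k + 1) + 2 ≤ g := by omega
    have hsum := sum_cost_le g (min k (g - k + 1)) (g - k) ks hmin hle hpairs
    have hr := rhs_le_A g k hg hk3 hk
    unfold rhs at hr
    linarith

end PercRepro.NightThree.StarStar
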